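import Literature.NumberTheory.EllipticCurves.Kato2004.IwasawaCohomology
import Literature.NumberTheory.GaloisRepresentations.ConjugationDescent
import Literature.NumberTheory.EllipticCurves.SelmerCorankControl
import HarnessLib

/-!
# Kato 2004 (14.14.1) / §13.8: the level-`0` projection of the pinned `𝐇¹_Γ(T_pW)` factors through
# the coinvariants `𝐇¹/X𝐇¹` (the first map `𝐇¹(T)⁰/X → A = H¹(ℤ[1/p], T)` of Kato's descent sequence)

Topic `NumberTheory/EllipticCurves/Kato2004`. Seat `bsd-potss-rkm` (cell `bsd-potss`, item
stmt-BirchSwinnertonDyer-19196): plumbing for P2/P3 of the realisation spec (the PIN of `A` and of the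
map `ι : 𝐇¹_Γ/X𝐇¹_Γ → A` of `KatoHullDescentDatum`): on the pinned interface `Kato2004.IwasawaH1Data`
(`proj_T_smul`: `T = X` acts as `conj_γ − 1`), the projection to the bottom layer kills `X·𝐇¹`, because
`γ` lies in the bottom layer subgroup `κ.layerSubgroup 0 = Γ_ℚ` and inner automorphisms act trivially on
`H¹` (`conjMap_eq_self_of_mem_one`). Hence `proj 0` induces an additive map
`𝐇¹_Γ/X𝐇¹_Γ → H¹(ℤ_0[1/p], T_pW) ⊆ H¹(ℚ, T_pW)` (`IwasawaH1Data.projZero`), Kato's injection of (14.14.1)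
(injectivity = the vanishing `𝐇¹(T)[X] = 0`/torsion-freeness side of (14.14.1), NOT proved here).
No new objects beyond this induced map; no named facts.

References: K. Kato, Astérisque 295 (2004), §13.8 (p. 228) and §14.14 (14.14.1) (p. 243)
[Kato2004Asterisque]; J.-P. Serre, *Local Fields* VII §5 Prop. 3 (inner action trivial on cohomology)
[SerreLocalFields1979].
-/

noncomputable section

open Field
open Literature.NumberTheory.GaloisRepresentations
open Literature.NumberTheory.EllipticCurves Literature.NumberTheory.EllipticCurves.Kato2004
open Literature.NumberTheory.EllipticCurves.Kato2004.EulerSystemValues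
open Literature.NumberTheory.EllipticCurves.IwasawaAlgebra

namespace Literature.NumberTheory.EllipticCurves.ZpExtension

/-- The bottom layer subgroup is everything: `κ.layerSubgroup 0 = Γ` (`p^0 = 1` divides every value).
[cite: Washington1997, §13.1] -/
theorem mem_layerSubgroup_zero {K : Type*} [Field K] {p : ℕ} [Fact p.Prime] (κ : ZpExtension K p)
    (σ : absoluteGaloisGroup K) : σ ∈ κ.layerSubgroup 0 := by
  rw [ZpExtension.mem_layerSubgroup, pow_zero]
  exact one_dvd _

end Literature.NumberTheory.EllipticCurves.ZpExtension

namespace Literature.NumberTheory.EllipticCurves.Kato2004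

variable {W : WeierstrassCurve ℚ} [W.IsElliptic] {p : ℕ} [Fact p.Prime]
  [ContinuousSMul ℤ_[p] (W.tateModule p)] {κ : ZpExtension ℚ p} {γ : absoluteGaloisGroup ℚ}
  (I : IwasawaH1Data W p κ γ)

/-- **`proj₀(X·x) = 0`**: at the bottom layer `T = conj_γ − 1` acts as zero, since `γ ∈ Γ_ℚ =
κ.layerSubgroup 0` acts trivially on `H¹(Γ_ℚ, T_pW)` (inner action). This is the well-definedness of the
first map of Kato's (14.14.1) `0 → 𝐇¹(T)/X𝐇¹(T) → H¹(ℤ[1/p], T)`.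
[cite: Kato2004Asterisque, §14.14 (14.14.1) (p. 243)] -/
theorem IwasawaH1Data.proj_zero_X_smul (x : I.H) :
    I.proj 0 ((PowerSeries.X : IwasawaAlgebra p) • x) = 0 := by
  rw [I.proj_T_smul, conjMap_eq_self_of_mem_one _ _ (κ.mem_layerSubgroup_zero γ), sub_self]

/-- `proj₀` vanishes on `X·𝐇¹`. [cite: Kato2004Asterisque, §14.14 (14.14.1) (p. 243)] -/
theorem IwasawaH1Data.proj_zero_eq_zero_of_mem_TSubmodule {x : I.H}
    (hx : x ∈ (Ideal.span {(PowerSeries.X : IwasawaAlgebra p)} • (⊤ : Submodule (IwasawaAlgebra p) I.H))) :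
    I.proj 0 x = 0 := by
  refine Submodule.smul_induction_on hx (fun r hr m _ ↦ ?_) (fun a b ha hb ↦ by rw [map_add, ha, hb, add_zero])
  · obtain ⟨s, rfl⟩ := Ideal.mem_span_singleton'.mp hr
    -- `s = C(s₀) + X·s'`, so `(s X)·m = s₀·(X·m) + X·(s'·(X·m))`, both killed by `proj 0`
    have hs : s = PowerSeries.C (PowerSeries.constantCoeff s) +
        PowerSeries.X * PowerSeries.mk fun n => PowerSeries.coeff (n + 1) s := by
      rw [← PowerSeries.sub_const_eq_X_mul_shift, add_sub_cancel]
    rw [mul_smul, hs, add_smul, map_add, I.proj_C_smul, I.proj_zero_X_smul, smul_zero, zero_add,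
      mul_smul, I.proj_zero_X_smul]

/-- **The induced map `proj₀ : 𝐇¹_Γ/X𝐇¹_Γ → H¹(Γ_ℚ = κ.layerSubgroup 0, T_pW)`** (values in the integral
classes `integralH1` at level `0` by `proj_mem`): the first arrow of Kato's (14.14.1) on the pinned
interface, as an additive map out of the coinvariants. (Plumbing definition; its injectivity — the other
half of (14.14.1) — is NOT claimed here.) [cite: Kato2004Asterisque, §14.14 (14.14.1) (p. 243)] -/
def IwasawaH1Data.projZero : coinvariants p I.H →+ H1 (tateRep W p) (κ.layerSubgroup 0) :=
  QuotientAddGroup.lift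
    ((Ideal.span {(PowerSeries.X : IwasawaAlgebra p)} • (⊤ : Submodule (IwasawaAlgebra p) I.H)).toAddSubgroup)
    (I.proj 0) fun _ hx ↦ (AddMonoidHom.mem_ker).mpr (I.proj_zero_eq_zero_of_mem_TSubmodule hx)

/-- `proj₀` on a class: `projZero [x] = proj 0 x`. [cite: Kato2004Asterisque, §14.14 (14.14.1) (p. 243)] -/
@[simp] theorem IwasawaH1Data.projZero_mk (x : I.H) :
    I.projZero (Submodule.Quotient.mk x) = I.proj 0 x :=
  rfl

/-- The values of `proj₀` are integral classes `H¹(ℤ[1/p], T_pW)` (= `integralH1` at level `0`).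
[cite: Kato2004Asterisque, §8.2 and §14.14 (pp. 180, 243)] -/
theorem IwasawaH1Data.projZero_mem (x : coinvariants p I.H) :
    I.projZero x ∈ integralH1 (tateRep W p) p (κ.layerSubgroup 0) := by
  induction x using Submodule.Quotient.induction_on with
  | H y => rw [IwasawaH1Data.projZero_mk]; exact I.proj_mem 0 y


end Literature.NumberTheory.EllipticCurves.Kato2004

end
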